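import Summits.Ventures.PercRepro.CogirthBlockFree
import Summits.Ventures.PercRepro.LineLadderBridge
import Summits.Ventures.PercRepro.K4LadderBridge
import Summits.Ventures.PercRepro.K4eLadderBridge
import Summits.Ventures.PercRepro.K5eLadderBridge
import Summits.Ventures.PercRepro.K5LadderBridge

/-!
# PercRepro — THEOREM G contains the block families of gens 13–15 (p9, gen 16)

The five family theorems of the window map — the line ladder `rls_lineLadder` (g13) and the base layers
`rls_k4Ladder`, `rls_k4eLadder`, `rls_k5eLadder`, `rls_k5Ladder` of the `K₄`, `K₄∖e`, `K₅∖e`, `K₅` families (g14–g15) —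
are re-derived here, at their exact statements (minus the hypotheses `2 ≤ q`, `q + 2 ≤ p` they never needed), from
the one theorem `rls_blockFree_of_rank_add` (`CogirthBlockFree`): only the rank of the block enters
(`2 / 3 / 3 / 4 / 4`; `rk univ` by `decide` on the blocks' own rank functions), no profile table and no base-layer
certificate. The layers below the base layer (`rls_k4Ladder_lower / _lowest / _layer6`, `rls_k4eLadder_layer4 / 5`,
`rls_k5eLadder_layer5 / 6 / 7`, `rls_k5Ladder_layer5 / 6 / 7`) are NOT instances — there the block is a flat of
nullity `> d − q`. Nothing about any window.
-/

namespace PercRepro.RankDist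

open Set Finset PercRepro.LineLadder

variable {α : Type}

/-- **The line ladder from THEOREM G**: `rls_lineLadder` (g13) without `2 ≤ q` and `q + 2 ≤ p`. -/
theorem rls_lineLadder' {L F : Set α} (hL : L.Finite) (hF : F.Finite) (hLF : Disjoint L F) (hL3 : L.ncard = 3)
    {m p q : ℕ} (hFm : F.ncard = m) (hm : p + q - 2 ≤ m) :
    @ThmN.RLS α (@PercRepro.Matroid.truncate α
        ((@PercRepro.Matroid.truncate α (Matroid.freeOn L) (freeOn_finite hL) 2).disjointSum (Matroid.freeOn F)
          (blocks_disjoint hL hLF)) (blockSum_finite hL hF hLF) p)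
      (@PercRepro.Matroid.truncate_finite α _ (blockSum_finite hL hF hLF) p) p q := by
  haveI := freeOn_finite hL
  have hr : (@PercRepro.Matroid.truncate α (Matroid.freeOn L) (freeOn_finite hL) 2).eRank = ((2 : ℕ) : ℕ∞) := by
    rw [PercRepro.Matroid.truncate_eRank, Matroid.eRank_freeOn, ← hL.cast_ncard_eq, hL3]
    rfl
  exact rls_blockFree_of_rank_add _ hF _ p q 2 hr (by omega)

/-- `ρ(M(K₄)) = 3`. -/
theorem K4_eRank : K4Ladder.K4.eRank = ((3 : ℕ) : ℕ∞) := by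
  rw [Matroid.eRank_def, K4Ladder.K4_ground, ← Finset.coe_univ, K4Ladder.eRk_coe]
  exact congrArg _ (by decide +kernel)

/-- `ρ(M(K₄ ∖ e)) = 3`. -/
theorem K4e_eRank : K4eLadder.K4e.eRank = ((3 : ℕ) : ℕ∞) := by
  rw [Matroid.eRank_def, K4eLadder.K4e_ground, ← Finset.coe_univ, K4eLadder.eRk_coe]
  exact congrArg _ (by decide +kernel)

/-- `ρ(M(K₅ ∖ e)) = 4`. -/
theorem K5e_eRank : K5eLadder.K5e.eRank = ((4 : ℕ) : ℕ∞) := by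
  rw [Matroid.eRank_def, K5eLadder.K5e_ground, ← Finset.coe_univ, K5eLadder.eRk_coe]
  exact congrArg _ (by decide +kernel)

/-- `ρ(M(K₅)) = 4`. -/
theorem K5_eRank : K5Ladder.K5.eRank = ((4 : ℕ) : ℕ∞) := by
  rw [Matroid.eRank_def, K5Ladder.K5_ground, ← Finset.coe_univ, K5Ladder.eRk_coe, ← K5Ladder.rkG_eq_rk]
  exact congrArg _ (by decide)

/-- **The `K₄` family from THEOREM G**: `rls_k4Ladder` (g14) without `q + 2 ≤ p`. -/
theorem rls_k4Ladder' (e : Fin 6 ↪ α) {F : Set α} (hF : F.Finite)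
    (hEF : Disjoint (K4Ladder.K4.mapEmbedding e).E (Matroid.freeOn F).E) {m p q : ℕ} (hFm : F.ncard = m)
    (hm : p + q - 3 ≤ m) :
    @ThmN.RLS α (@PercRepro.Matroid.truncate α ((K4Ladder.K4.mapEmbedding e).disjointSum (Matroid.freeOn F) hEF)
        (@blockFree_finite α _ (K4Ladder.mapK4_finite e) F hF hEF) p)
      (@PercRepro.Matroid.truncate_finite α _ (@blockFree_finite α _ (K4Ladder.mapK4_finite e) F hF hEF) p) p q := by
  haveI := K4Ladder.mapK4_finite e
  have hr : (K4Ladder.K4.mapEmbedding e).eRank = ((3 : ℕ) : ℕ∞) := by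
    rw [Matroid.mapEmbedding, Matroid.eRank_map, K4_eRank]
  exact rls_blockFree_of_rank_add _ hF hEF p q 3 hr (by omega)

/-- **The `K₄ ∖ e` family from THEOREM G**: `rls_k4eLadder` (g15) without `q + 2 ≤ p`. -/
theorem rls_k4eLadder' (e : Fin 5 ↪ α) {F : Set α} (hF : F.Finite)
    (hEF : Disjoint (K4eLadder.K4e.mapEmbedding e).E (Matroid.freeOn F).E) {m p q : ℕ} (hFm : F.ncard = m)
    (hm : p + q - 3 ≤ m) :
    @ThmN.RLS α (@PercRepro.Matroid.truncate α ((K4eLadder.K4e.mapEmbedding e).disjointSum (Matroid.freeOn F) hEF)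
        (@blockFree_finite α _ (K4eLadder.mapK4e_finite e) F hF hEF) p)
      (@PercRepro.Matroid.truncate_finite α _ (@blockFree_finite α _ (K4eLadder.mapK4e_finite e) F hF hEF) p) p q := by
  haveI := K4eLadder.mapK4e_finite e
  have hr : (K4eLadder.K4e.mapEmbedding e).eRank = ((3 : ℕ) : ℕ∞) := by
    rw [Matroid.mapEmbedding, Matroid.eRank_map, K4e_eRank]
  exact rls_blockFree_of_rank_add _ hF hEF p q 3 hr (by omega)

/-- **The `K₅ ∖ e` family from THEOREM G**: `rls_k5eLadder` (g15) without `q + 2 ≤ p`. -/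
theorem rls_k5eLadder' (e : Fin 9 ↪ α) {F : Set α} (hF : F.Finite)
    (hEF : Disjoint (K5eLadder.K5e.mapEmbedding e).E (Matroid.freeOn F).E) {m p q : ℕ} (hFm : F.ncard = m)
    (hm : p + q - 4 ≤ m) :
    @ThmN.RLS α (@PercRepro.Matroid.truncate α ((K5eLadder.K5e.mapEmbedding e).disjointSum (Matroid.freeOn F) hEF)
        (@blockFree_finite α _ (K5eLadder.mapK5e_finite e) F hF hEF) p)
      (@PercRepro.Matroid.truncate_finite α _ (@blockFree_finite α _ (K5eLadder.mapK5e_finite e) F hF hEF) p) p q := by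
  haveI := K5eLadder.mapK5e_finite e
  have hr : (K5eLadder.K5e.mapEmbedding e).eRank = ((4 : ℕ) : ℕ∞) := by
    rw [Matroid.mapEmbedding, Matroid.eRank_map, K5e_eRank]
  exact rls_blockFree_of_rank_add _ hF hEF p q 4 hr (by omega)

/-- **The `K₅` family from THEOREM G**: `rls_k5Ladder` (g15) without `q + 2 ≤ p`. -/
theorem rls_k5Ladder' (e : Fin 10 ↪ α) {F : Set α} (hF : F.Finite)
    (hEF : Disjoint (K5Ladder.K5.mapEmbedding e).E (Matroid.freeOn F).E) {m p q : ℕ} (hFm : F.ncard = m)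
    (hm : p + q - 4 ≤ m) :
    @ThmN.RLS α (@PercRepro.Matroid.truncate α ((K5Ladder.K5.mapEmbedding e).disjointSum (Matroid.freeOn F) hEF)
        (@blockFree_finite α _ (K5Ladder.mapK5_finite e) F hF hEF) p)
      (@PercRepro.Matroid.truncate_finite α _ (@blockFree_finite α _ (K5Ladder.mapK5_finite e) F hF hEF) p) p q := by
  haveI := K5Ladder.mapK5_finite e
  have hr : (K5Ladder.K5.mapEmbedding e).eRank = ((4 : ℕ) : ℕ∞) := by
    rw [Matroid.mapEmbedding, Matroid.eRank_map, K5_eRank]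
  exact rls_blockFree_of_rank_add _ hF hEF p q 4 hr (by omega)

end PercRepro.RankDist
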